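import Literature.AnabelianGeometry.EtaleTheta.ThetaTwistTowerThetaCoordinate
import Literature.AnabelianGeometry.EtaleTheta.Discharge.Sec5Def54bAtPinnedQ

/-!
# [EtTh] Definition 5.4 (b) DECIDED at the FOURTH tower model: at the level-`(n+1)` Galois object `Y_{n+1} = Compat₃′/V_{n+1}`,
# `#((l·Δ_Θ)_{Y_{n+1}} ⊗ ℤ/Nℤ) = N` IFF `N ∣ (n+2)!/gcd((n+2)!, l)`

Mochizuki, *The étale theta function and its Frobenioid-theoretic manifestations*, Publ. RIMS **45** (2009), Def. 5.4 (b) p.327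
(PDF p.101): «(b) `(l·Δ_Θ)_S ⊗ ℤ/Nℤ` is of cardinality `N`»; §5 p.327 «`(l·Δ_Θ)_D ⊆ Aut^Θ_D(D)`».  [cite: MochizukiEtTh2009, Def 5.4 p.327 (PDF p.101)]

abc-iut cell, layer L2, seat abc-iut-L2-t4 (gen 9), row «DEF54b-INDEX@FOURTH-MODEL» FILE B (abc-iut-L2-lead R1223 GO).  PROOF-ONLY: no
definition, no new `Prop`, no instance, no notation; nothing landed is edited or restated.  Consumed BY NAME: FILE A
(`ThetaTwistTowerThetaCoordinate.lean`: `compatFam`, `thetaEmb`, `thetaι`, `thetaStub`), abc-iut-L1-t6 / abc-iut-w5-d034's levels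
`vSub` / `vOpenNormal` (`V_n`: trivial translation and trivial data of every index `< n`) and `isTemperedC`, abc-iut-L2-t9's
`ThetaSubquotient.lDeltaQEquiv` (`(l·Δ_Θ)_{Π/V} ≃ Λ ⧸ ι⁻¹(q(V) ∩ L)`), this seat's `ThetaSubquotientStub.card_lDelta_quotient_pow_eq_iff_dvd`
(p502778), Mathlib `ZMod.addOrderOf_coe` / `Nat.card_zmultiples` / `QuotientGroup.quotientKerEquivRange`.

WHAT IS PROVED (`Λ := compatFam ≅ Ẑ`, `ι_l = thetaι l`, `V_n = vOpenNormal 3 thetaShear n`, `Y_n := Compat₃′/V_n`):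
* `nonempty_lDelta_thetaStub_mulEquiv_range` — `(l·Δ_Θ)_{Y_{n+1}} ≃* l·(ℤ/(n+2)!)` (FILE A: `ι_l⁻¹(V_{n+1}) = Ker(a ↦ l·a_n)`, range the
  multiples of `l`), hence
  **`card_lDelta_thetaStub_succ`: `#(l·Δ_Θ)_{Y_{n+1}} = (n+2)!/gcd((n+2)!, l)`**, finite cyclic;
* **`card_lDelta_thetaStub_quotient_pow_eq_iff`** — Def. 5.4 (b) at `Y_{n+1}`: `#((l·Δ_Θ)_{Y_{n+1}} ⊗ ℤ/Nℤ) = N ⟺ N ∣ (n+2)!/gcd((n+2)!, l)`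
  — DECIDED BOTH WAYS: TRUE at every level `n+1` with `N ∣ (n+2)!/gcd((n+2)!,l)` (`…_of_dvd`; e.g. `(l, N, n+1) = (3, 4, 3)`,
  `card_lDelta_thetaStub_three_four`), FALSE below (e.g. level `1`, `N = 3`, every `l`: `card_lDelta_thetaStub_one_three_ne`).
HONEST LABEL (abc-iut-L2-lead R1223): «(b) TRUE at levels with `N ∣ M_n`, FALSE below — an index statement about OUR tower»: a
class-(b) design model whose Θ̈-Kummer coordinate `L_Θ ≅ Ẑ` stands in for `Δ_Θ ≅ Ẑ(1)`; stub vocabulary `ThetaSubquotientStub.lDelta` at the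
pinned stub `thetaStub l`, NOT `ThetaFrobenioid.IsThetaSaturated` (no ThetaFrobenioid over the tower); the cell's Def. 5.4 count is the
lead's call.  [EtTh] is a refereed paper; nothing here bears on [IUTchIII] Cor. 3.12 — no side taken; nothing asserts abc proved or refuted.
-/

noncomputable section

namespace Literature.AnabelianGeometry.EtaleTheta

open CategoryTheory Function Literature.AlgebraicGeometry.Frobenioids Literature.AnabelianGeometry.SemiGraphs

namespace TateTowerKummerTwistRShear

namespace ThetaCoord

open TateTowerKummerTwist (M one_lt_M Cst M_dvd res resC)
open TateTowerKummerTwistR (KumAdd Kum resK resK_apply)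

/-! ### `(l·Δ_Θ)_{Y_{n+1}} ≃ l·(ℤ/(n+2)!)`, its cardinality -/

/-- The Galois object `Y_n = Compat₃′/V_n` of `B^temp(Compat₃′)` is connected. [cite: MochizukiEtTh2009, §5 p.327 (PDF p.101)] -/
theorem isConnectedObj_Y (n : ℕ) : IsConnectedObj (BTemp.Q (isTemperedC 3 thetaShear) (vOpenNormal 3 thetaShear n)) :=
  ThetaSubquotient.isConnectedObj_Q (isTemperedC 3 thetaShear) _

/-- **`(l·Δ_Θ)_{Y_{n+1}} ≃* l·(ℤ/(n+2)!)`** — abc-iut-L2-t9's `lDeltaQEquiv` at `q = id` gives `(l·Δ_Θ)_{Y_{n+1}} ≃ Λ ⧸ ι_l⁻¹(V_{n+1})`, and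
`ι_l⁻¹(V_{n+1}) = Ker(a ↦ l·a_n)` with range the multiples of `l` (FILE A). [cite: MochizukiEtTh2009, §5 p.327 (PDF p.101)] -/
theorem nonempty_lDelta_thetaStub_mulEquiv_range (l n : ℕ) :
    Nonempty ((thetaStub l).lDelta ⟨BTemp.Q (isTemperedC 3 thetaShear) (vOpenNormal 3 thetaShear (n + 1)), isConnectedObj_Y (n + 1)⟩ ≃*
      ↥(thetaEval l n).range) := by
  haveI := thetaι_range_normal l
  exact ⟨((ThetaSubquotient.lDeltaQEquiv (isTemperedC 3 thetaShear) (MonoidHom.id (Compat 3 thetaShear)) (thetaι l)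
      Function.surjective_id (vOpenNormal 3 thetaShear (n + 1))).trans
    (QuotientGroup.quotientMulEquivOfEq (preimage_vSub_succ_eq_ker l n))).trans
      (QuotientGroup.quotientKerEquivRange (thetaEval l n))⟩

/-- **`#(l·Δ_Θ)_{Y_{n+1}} = (n+2)!/gcd((n+2)!, l)`** (`M n = (n+2)!`). [cite: MochizukiEtTh2009, Def 5.4 p.327 (PDF p.101)] -/
theorem card_lDelta_thetaStub_succ (l n : ℕ) :
    Nat.card ((thetaStub l).lDelta ⟨BTemp.Q (isTemperedC 3 thetaShear) (vOpenNormal 3 thetaShear (n + 1)), isConnectedObj_Y (n + 1)⟩) =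
      M n / Nat.gcd (M n) l := by
  obtain ⟨e⟩ := nonempty_lDelta_thetaStub_mulEquiv_range l n
  rw [Nat.card_congr e.toEquiv, card_range_thetaEval]

/-- `(l·Δ_Θ)_{Y_{n+1}}` is finite … [cite: MochizukiEtTh2009, Def 5.4 p.327 (PDF p.101)] -/
theorem finite_lDelta_thetaStub_succ (l n : ℕ) :
    Finite ((thetaStub l).lDelta ⟨BTemp.Q (isTemperedC 3 thetaShear) (vOpenNormal 3 thetaShear (n + 1)), isConnectedObj_Y (n + 1)⟩) := by
  haveI : NeZero (M n) := ⟨(Nat.factorial_pos _).ne'⟩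
  obtain ⟨e⟩ := nonempty_lDelta_thetaStub_mulEquiv_range l n
  exact Finite.of_equiv _ e.symm.toEquiv

/-- … and cyclic (a quotient of `Λ ≅ Ẑ`, realised inside the cyclic group `ℤ/(n+2)!`). [cite: MochizukiEtTh2009, Def 5.4 p.327 (PDF p.101)] -/
theorem isCyclic_lDelta_thetaStub_succ (l n : ℕ) :
    IsCyclic ((thetaStub l).lDelta ⟨BTemp.Q (isTemperedC 3 thetaShear) (vOpenNormal 3 thetaShear (n + 1)), isConnectedObj_Y (n + 1)⟩) := by
  obtain ⟨e⟩ := nonempty_lDelta_thetaStub_mulEquiv_range l n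
  exact isCyclic_of_surjective e.symm.toMonoidHom e.symm.surjective

/-! ### Def. 5.4 (b) at the fourth model — DECIDED -/

/-- **[EtTh] Def. 5.4 (b) at the fourth tower model, DECIDED**: at the level-`(n+1)` Galois object `Y_{n+1} = Compat₃′/V_{n+1}` of
`B^temp(Compat₃′)⁰`, for the pinned stub `thetaStub l` (`ι = l·L_Θ`), **`#((l·Δ_Θ)_{Y_{n+1}} ⊗ ℤ/Nℤ) = N ⟺ N ∣ (n+2)!/gcd((n+2)!, l)`**
(this seat's `ThetaSubquotientStub.card_lDelta_quotient_pow_eq_iff_dvd`, p502778, at the cyclic group of FILE A).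
[cite: MochizukiEtTh2009, Def 5.4 p.327 (PDF p.101)] -/
theorem card_lDelta_thetaStub_quotient_pow_eq_iff (l n : ℕ) (N : ℕ+) :
    Nat.card ((thetaStub l).lDelta ⟨BTemp.Q (isTemperedC 3 thetaShear) (vOpenNormal 3 thetaShear (n + 1)), isConnectedObj_Y (n + 1)⟩ ⧸
        (powMonoidHom (N : ℕ) :
          (thetaStub l).lDelta ⟨BTemp.Q (isTemperedC 3 thetaShear) (vOpenNormal 3 thetaShear (n + 1)), isConnectedObj_Y (n + 1)⟩ →*
          (thetaStub l).lDelta ⟨BTemp.Q (isTemperedC 3 thetaShear) (vOpenNormal 3 thetaShear (n + 1)), isConnectedObj_Y (n + 1)⟩).range) = N ↔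
      (N : ℕ) ∣ M n / Nat.gcd (M n) l := by
  haveI := finite_lDelta_thetaStub_succ l n
  haveI := isCyclic_lDelta_thetaStub_succ l n
  rw [(thetaStub l).card_lDelta_quotient_pow_eq_iff_dvd _ N, card_lDelta_thetaStub_succ]

/-- The TRUE side: Def. 5.4 (b) holds at `Y_{n+1}` whenever `N ∣ (n+2)!/gcd((n+2)!, l)` — in particular at every level `n+1 ≥ l·N`.
[cite: MochizukiEtTh2009, Def 5.4 p.327 (PDF p.101)] -/
theorem card_lDelta_thetaStub_quotient_pow_of_dvd (l n : ℕ) (N : ℕ+) (h : (N : ℕ) ∣ M n / Nat.gcd (M n) l) :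
    Nat.card ((thetaStub l).lDelta ⟨BTemp.Q (isTemperedC 3 thetaShear) (vOpenNormal 3 thetaShear (n + 1)), isConnectedObj_Y (n + 1)⟩ ⧸
        (powMonoidHom (N : ℕ) :
          (thetaStub l).lDelta ⟨BTemp.Q (isTemperedC 3 thetaShear) (vOpenNormal 3 thetaShear (n + 1)), isConnectedObj_Y (n + 1)⟩ →*
          (thetaStub l).lDelta ⟨BTemp.Q (isTemperedC 3 thetaShear) (vOpenNormal 3 thetaShear (n + 1)), isConnectedObj_Y (n + 1)⟩).range) = N :=
  (card_lDelta_thetaStub_quotient_pow_eq_iff l n N).mpr h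

/-- The FALSE side: Def. 5.4 (b) FAILS at `Y_{n+1}` whenever `N ∤ (n+2)!/gcd((n+2)!, l)` (small levels).
[cite: MochizukiEtTh2009, Def 5.4 p.327 (PDF p.101)] -/
theorem card_lDelta_thetaStub_quotient_pow_ne_of_not_dvd (l n : ℕ) (N : ℕ+) (h : ¬ (N : ℕ) ∣ M n / Nat.gcd (M n) l) :
    Nat.card ((thetaStub l).lDelta ⟨BTemp.Q (isTemperedC 3 thetaShear) (vOpenNormal 3 thetaShear (n + 1)), isConnectedObj_Y (n + 1)⟩ ⧸
        (powMonoidHom (N : ℕ) :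
          (thetaStub l).lDelta ⟨BTemp.Q (isTemperedC 3 thetaShear) (vOpenNormal 3 thetaShear (n + 1)), isConnectedObj_Y (n + 1)⟩ →*
          (thetaStub l).lDelta ⟨BTemp.Q (isTemperedC 3 thetaShear) (vOpenNormal 3 thetaShear (n + 1)), isConnectedObj_Y (n + 1)⟩).range) ≠ N :=
  fun hc => h ((card_lDelta_thetaStub_quotient_pow_eq_iff l n N).mp hc)

/-- **Instance (l, N) = (3, 4) at level `3`** (`n = 2`: `4!/gcd(4!, 3) = 8` and `4 ∣ 8`): Def. 5.4 (b) HOLDS at `Y_3` for `l = 3`, `N = 4`.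
[cite: MochizukiEtTh2009, Def 5.4 p.327 (PDF p.101)] -/
theorem card_lDelta_thetaStub_three_four :
    Nat.card ((thetaStub 3).lDelta ⟨BTemp.Q (isTemperedC 3 thetaShear) (vOpenNormal 3 thetaShear 3), isConnectedObj_Y 3⟩ ⧸
        (powMonoidHom ((4 : ℕ+) : ℕ) :
          (thetaStub 3).lDelta ⟨BTemp.Q (isTemperedC 3 thetaShear) (vOpenNormal 3 thetaShear 3), isConnectedObj_Y 3⟩ →*
          (thetaStub 3).lDelta ⟨BTemp.Q (isTemperedC 3 thetaShear) (vOpenNormal 3 thetaShear 3), isConnectedObj_Y 3⟩).range) = (4 : ℕ+) :=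
  card_lDelta_thetaStub_quotient_pow_of_dvd 3 2 4 (by decide)

/-- **Instance of the FALSE side: level `1`, `N = 3`** (`n = 0`: `2!/gcd(2!, l) ∈ {1, 2}`, never divisible by `3`): Def. 5.4 (b) FAILS at
`Y_1` for every `l` and `N = 3`. [cite: MochizukiEtTh2009, Def 5.4 p.327 (PDF p.101)] -/
theorem card_lDelta_thetaStub_one_three_ne (l : ℕ) :
    Nat.card ((thetaStub l).lDelta ⟨BTemp.Q (isTemperedC 3 thetaShear) (vOpenNormal 3 thetaShear 1), isConnectedObj_Y 1⟩ ⧸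
        (powMonoidHom ((3 : ℕ+) : ℕ) :
          (thetaStub l).lDelta ⟨BTemp.Q (isTemperedC 3 thetaShear) (vOpenNormal 3 thetaShear 1), isConnectedObj_Y 1⟩ →*
          (thetaStub l).lDelta ⟨BTemp.Q (isTemperedC 3 thetaShear) (vOpenNormal 3 thetaShear 1), isConnectedObj_Y 1⟩).range) ≠ (3 : ℕ+) := by
  refine card_lDelta_thetaStub_quotient_pow_ne_of_not_dvd l 0 3 fun h => ?_
  -- `M 0 = 2`, so `2 / gcd 2 l ≤ 2` is not divisible by `3`
  have hM : M 0 = 2 := rfl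
  rw [hM] at h
  have hle : 2 / Nat.gcd 2 l ≤ 2 := Nat.div_le_self _ _
  have hpos : 0 < 2 / Nat.gcd 2 l := Nat.div_pos (Nat.le_of_dvd (by norm_num) (Nat.gcd_dvd_left 2 l)) (Nat.gcd_pos_of_pos_left _ (by norm_num))
  have h3 : (3 : ℕ) ≤ 2 / Nat.gcd 2 l := Nat.le_of_dvd hpos h
  omega

end ThetaCoord

end TateTowerKummerTwistRShear

end Literature.AnabelianGeometry.EtaleTheta

end
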